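import Literature.Computability.QuantumComplexity.ZeroNoiseExtrapolation
import Mathlib.Probability.Moments.Variance
import Mathlib.Probability.Independence.Basic
import HarnessLib

/-!
# Zero-noise (Richardson) extrapolation: the variance of the estimate and two printed factors

Topic `Literature/Computability/QuantumComplexity` (pub-qadeq lane; companion of
`ZeroNoiseExtrapolation.lean`, which fixes the coefficients `γ_j = richardsonCoeff c j`, the
estimate `Ê^n = Σ_j γ_j Ê_j` and the coefficient inequality `Σ_j γ_j² ≤ (Σ_j |γ_j|)²` but not the
PROBABILISTIC statement those numbers enter).

HONEST FRAMING: instance-level adjudication of specific advantage claims; no claim about BQP vs BPP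
or the summit. Nothing here says that any device's noisy expectation values have a polynomial
dependence on the amplification factor, nor that the level estimates of any experiment ARE
independent; the file records the variance arithmetic of the Richardson estimator as printed, so a
lane report quoting a device's ZNE point (CLAIMS E-17 / E-21 / E-22 / E-37 / E-44 / E-47; S-6's
H2 'ZNE&ZNR' comparisons) can state the factor from the printed scale factors alone.

## Sources (verbatim)

[MohammadipourLi2025] P. Mohammadipour, X. Li, *Direct analysis of zero-noise extrapolation*,
Quantum 9, 1909 (2025) = arXiv:2502.20673, §2 (held chunk p0006): "`Var[p_n(0)] = Σ_j γ_j²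
Var[f̂(x_j)] … ≤ (σ²/N_S) Σ_j γ_j² ≤ (σ²/N_S) (Σ_j |γ_j|)²`".

[KosterMauerer2026] D. Köster, W. Mauerer, *Claim against Measurement: Statistical Artefacts in
Quantum Error Mitigation Benchmarks*, arXiv:2605.29872 (2026), p. 2 (held text
`paper:arxiv-2605.29872` p0002 L76–96): "The zero-noise limit is in this case estimated as
`Ê(0) = Σ_{k=1}^K c_k E(λ_k)`, where `Σ_{k=1}^K c_k = 1`, and coefficients `c_k` are determined by
Lagrange interpolation. Since `Var(Ê_ZNE) = Σ_{k=1}^K c_k² Var(Ê(λ_k))`, a convenient pre-experiment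
bound on variance amplification is `Σ_{k=1}^K |c_k|` – computable from the scale factors alone,
without running any circuits. For the widely used default set `{1,3,5}`, `Σ |c_k| = 3.5`, whereas
`{1,1.1,1.25,1.5}` … yields `Σ |c_k| = 681`: a 194× difference in the variance bound."

## Contents (all proved; 0 named facts; standard axioms)

* **`ZNE.variance_estimate_eq`** — for pairwise INDEPENDENT square-integrable level estimates
  `Ê_j : Ω → ℝ` (any measure), `Var[Ê^n] = Σ_j γ_j² Var[Ê_j]` (the printed identity; Mathlib's
  `IndepFun.variance_sum` + `variance_const_mul`).
* **`ZNE.variance_estimate_le`** — if moreover `Var[Ê_j] ≤ v` for all `j`, then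
  `Var[Ê^n] ≤ (Σ_j |γ_j|)² · v` (the "pre-experiment bound on variance amplification", via the
  tree's `sum_sq_richardsonCoeff_le`).
* The two printed numbers, certified over `ℚ` by evaluation of `richardsonCoeff`
  (`nodesDefault = (1, 3, 5)`, `nodesFine = (1, 11/10, 5/4, 3/2)`):
  `richardsonCoeff_nodesDefault_zero/one/two` (`γ = (15/8, −5/4, 3/8)`),
  **`ZNE.sum_abs_richardsonCoeff_nodesDefault`** (`Σ|γ| = 7/2 = 3.5`),
  `richardsonCoeff_nodesFine_zero/one/two/three` (`γ = (165, −625/2, 176, −55/2)`),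
  **`ZNE.sum_abs_richardsonCoeff_nodesFine`** (`Σ|γ| = 681`) and `ratio_nodesFine_nodesDefault`
  ("a 194× difference": `3.5·194 ≤ 681 < 3.5·195`).

## References

* [MohammadipourLi2025] Quantum 9, 1909 (2025) = arXiv:2502.20673, §2.
* [KosterMauerer2026] arXiv:2605.29872, p. 2.
* [TemmeBravyiGambetta2017] PRL 119, 180509 — the estimator itself (tree file
  `ZeroNoiseExtrapolation.lean`).
-/

noncomputable section

open Finset MeasureTheory ProbabilityTheory

namespace Literature.Computability.QuantumComplexity

namespace ZNE

/-! ### The variance of the Richardson estimate -/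

section Variance

variable {Ω : Type*} {mΩ : MeasurableSpace Ω} {μ : Measure Ω} {n : ℕ}

/-- **`Var[Ê^n] = Σ_j γ_j² Var[Ê_j]`** for pairwise independent, square-integrable level estimates
`Ê_j` (random variables on any measure space; the estimate is formed pointwise,
`ω ↦ Σ_j γ_j Ê_j(ω)`). [cite: MohammadipourLi2025, §2 (Var[p_n(0)] = Σ_j γ_j² Var[f̂(x_j)])]
[cite: KosterMauerer2026, p. 2 (Var(Ê_ZNE) = Σ c_k² Var(Ê(λ_k)))] -/
theorem variance_estimate_eq (c : Fin (n + 1) → ℝ) (E : Fin (n + 1) → Ω → ℝ)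
    (hE : ∀ j, MemLp (E j) 2 μ)
    (hind : Set.Pairwise (Set.univ : Set (Fin (n + 1))) fun i j => IndepFun (E i) (E j) μ) :
    variance (fun ω => estimate c (fun j => E j ω)) μ =
      ∑ j, richardsonCoeff c j ^ 2 * variance (E j) μ := by
  have hfun : (fun ω => estimate c (fun j => E j ω)) =
      ∑ j, (fun ω => richardsonCoeff c j * E j ω) := by
    funext ω
    simp only [estimate_eq, Finset.sum_apply]
  rw [hfun, IndepFun.variance_sum]
  · exact Finset.sum_congr rfl fun j _ => variance_const_mul _ _ _
  · intro j _
    exact (hE j).const_mul _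
  · intro i _ j _ hij
    exact (hind (Set.mem_univ i) (Set.mem_univ j) hij).comp (measurable_const_mul _)
      (measurable_const_mul _)

/-- **The pre-experiment bound on variance amplification**: with pairwise independent level
estimates of variance at most `v` each, `Var[Ê^n] ≤ (Σ_j |γ_j|)² · v` — "computable from the scale
factors alone, without running any circuits". [cite: MohammadipourLi2025, §2 (≤ (σ²/N_S)(Σ|γ_j|)²)]
[cite: KosterMauerer2026, p. 2 (Σ|c_k| as the variance-amplification bound)] -/
theorem variance_estimate_le (c : Fin (n + 1) → ℝ) (E : Fin (n + 1) → Ω → ℝ)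
    (hE : ∀ j, MemLp (E j) 2 μ)
    (hind : Set.Pairwise (Set.univ : Set (Fin (n + 1))) fun i j => IndepFun (E i) (E j) μ)
    {v : ℝ} (hv : ∀ j, variance (E j) μ ≤ v) :
    variance (fun ω => estimate c (fun j => E j ω)) μ ≤ (∑ j, |richardsonCoeff c j|) ^ 2 * v := by
  rw [variance_estimate_eq c E hE hind]
  have hv0 : 0 ≤ v := (variance_nonneg _ _).trans (hv 0)
  calc ∑ j, richardsonCoeff c j ^ 2 * variance (E j) μ
      ≤ ∑ j, richardsonCoeff c j ^ 2 * v :=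
        Finset.sum_le_sum fun j _ => mul_le_mul_of_nonneg_left (hv j) (sq_nonneg _)
    _ = (∑ j, richardsonCoeff c j ^ 2) * v := (Finset.sum_mul _ _ _).symm
    _ ≤ (∑ j, |richardsonCoeff c j|) ^ 2 * v :=
        mul_le_mul_of_nonneg_right (sum_sq_richardsonCoeff_le c) hv0

end Variance

/-! ### The two printed amplification factors -/

section PrintedFactors

/-- The "widely used default set" of scale factors `{1, 3, 5}`. [cite: KosterMauerer2026, p. 2] -/
def nodesDefault : Fin 3 → ℚ := ![1, 3, 5]

/-- The fine set of scale factors `{1, 1.1, 1.25, 1.5}`. [cite: KosterMauerer2026, p. 2] -/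
def nodesFine : Fin 4 → ℚ := ![1, 11 / 10, 5 / 4, 3 / 2]

/-- Evaluation rule for one Richardson coefficient: erase = filter, then expand the product.
[folklore] -/
private theorem richardsonCoeff_eq_prod_ite {m : ℕ} (c : Fin (m + 1) → ℚ) (j : Fin (m + 1)) :
    richardsonCoeff c j = ∏ k, if k ≠ j then c k / (c k - c j) else 1 := by
  rw [richardsonCoeff, ← Finset.filter_ne', Finset.prod_filter]

/-- `{1, 3, 5}`: `γ₀ = 15/8`. [cite: KosterMauerer2026, p. 2] -/
theorem richardsonCoeff_nodesDefault_zero : richardsonCoeff nodesDefault 0 = 15 / 8 := by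
  rw [richardsonCoeff_eq_prod_ite, Fin.prod_univ_three]; simp [nodesDefault]; norm_num

/-- `{1, 3, 5}`: `γ₁ = −5/4`. [cite: KosterMauerer2026, p. 2] -/
theorem richardsonCoeff_nodesDefault_one : richardsonCoeff nodesDefault 1 = -5 / 4 := by
  rw [richardsonCoeff_eq_prod_ite, Fin.prod_univ_three]; simp [nodesDefault]; norm_num

/-- `{1, 3, 5}`: `γ₂ = 3/8`. [cite: KosterMauerer2026, p. 2] -/
theorem richardsonCoeff_nodesDefault_two : richardsonCoeff nodesDefault 2 = 3 / 8 := by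
  rw [richardsonCoeff_eq_prod_ite, Fin.prod_univ_three]; simp [nodesDefault]; norm_num

/-- **`Σ |γ_j| = 7/2 = 3.5`** for the default set `{1, 3, 5}`.
[cite: KosterMauerer2026, p. 2 ("For the widely used default set {1,3,5}, Σ|c_k| = 3.5")] -/
theorem sum_abs_richardsonCoeff_nodesDefault :
    ∑ j, |richardsonCoeff nodesDefault j| = 7 / 2 := by
  rw [Fin.sum_univ_three, richardsonCoeff_nodesDefault_zero, richardsonCoeff_nodesDefault_one,
    richardsonCoeff_nodesDefault_two]
  norm_num

/-- `{1, 1.1, 1.25, 1.5}`: `γ₀ = 165`. [cite: KosterMauerer2026, p. 2] -/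
theorem richardsonCoeff_nodesFine_zero : richardsonCoeff nodesFine 0 = 165 := by
  rw [richardsonCoeff_eq_prod_ite, Fin.prod_univ_four]; simp [nodesFine]; norm_num

/-- `{1, 1.1, 1.25, 1.5}`: `γ₁ = −625/2`. [cite: KosterMauerer2026, p. 2] -/
theorem richardsonCoeff_nodesFine_one : richardsonCoeff nodesFine 1 = -625 / 2 := by
  rw [richardsonCoeff_eq_prod_ite, Fin.prod_univ_four]; simp [nodesFine]; norm_num

/-- `{1, 1.1, 1.25, 1.5}`: `γ₂ = 176`. [cite: KosterMauerer2026, p. 2] -/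
theorem richardsonCoeff_nodesFine_two : richardsonCoeff nodesFine 2 = 176 := by
  rw [richardsonCoeff_eq_prod_ite, Fin.prod_univ_four]; simp [nodesFine]; norm_num

/-- `{1, 1.1, 1.25, 1.5}`: `γ₃ = −55/2`. [cite: KosterMauerer2026, p. 2] -/
theorem richardsonCoeff_nodesFine_three : richardsonCoeff nodesFine 3 = -55 / 2 := by
  rw [richardsonCoeff_eq_prod_ite, Fin.prod_univ_four]; simp [nodesFine]; norm_num

/-- **`Σ |γ_j| = 681`** for the fine set `{1, 1.1, 1.25, 1.5}` ("a 194× difference in the variance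
bound" against `3.5`; `681 / 3.5 = 194.57…`).
[cite: KosterMauerer2026, p. 2 ("{1,1.1,1.25,1.5} … yields Σ|c_k| = 681")] -/
theorem sum_abs_richardsonCoeff_nodesFine :
    ∑ j, |richardsonCoeff nodesFine j| = 681 := by
  rw [Fin.sum_univ_four, richardsonCoeff_nodesFine_zero, richardsonCoeff_nodesFine_one,
    richardsonCoeff_nodesFine_two, richardsonCoeff_nodesFine_three]
  norm_num

/-- The printed ratio: `3.5 · 194 ≤ 681 < 3.5 · 195`.
[cite: KosterMauerer2026, p. 2 ("a 194× difference")] -/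
theorem ratio_nodesFine_nodesDefault :
    (7 / 2 : ℚ) * 194 ≤ 681 ∧ (681 : ℚ) < 7 / 2 * 195 := by
  norm_num

end PrintedFactors

end ZNE

end Literature.Computability.QuantumComplexity

end
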